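import Mathlib.NumberTheory.NumberField.Basic
import Mathlib.NumberTheory.NumberField.Discriminant.Basic
import Mathlib.NumberTheory.NumberField.Ideal.KummerDedekind
import Mathlib.RingTheory.Discriminant
import Mathlib.FieldTheory.Minpoly.IsIntegrallyClosed
import Mathlib.Algebra.Polynomial.SpecificDegree
import Mathlib.Algebra.Polynomial.Eval.Irreducible
import Mathlib.FieldTheory.Galois.Basic
import Mathlib.NumberTheory.NumberField.Units.DirichletTheorem
import Mathlib.Topology.Algebra.Polynomial
import Mathlib.Analysis.SpecialFunctions.Pow.Real
import Mathlib.Data.Sign.Basic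
import Literature.NumberTheory.NumberFields.IntegralBasisCriterion
import Literature.NumberTheory.LFunctions.DegreeOnePrimes
import HarnessLib

/-!
# The cyclic cubic field of conductor `13`: `K = ℚ(θ)`, `θ³ + θ² - 4θ + 1 = 0`

The unique cubic subfield of `ℚ(ζ₁₃)` — the smallest of the four cubic subfields of the degree-`9`
field `F₃ ⊂ ℚ(ζ₁₃, ζ₁₀₃)` of T. Dokchitser–V. Dokchitser, *A note on the Mordell–Weil rank modulo
`n`*, J. Number Theory 131 (2011), proof of Thm. 2 (the fields over which "2-descent shows that
`rk E/F₃ = 1` […] over all minimal non-trivial subfields"; tree files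
`Literature/Barriers/BirchSwinnertonDyer/RankNotSumOfLocalInvariantsF3*.lean`) — made explicit as
`K = ℚ[X]/(f)`, `f = X³ + X² - 4X + 1` (the period polynomial of conductor `13`: its roots are the
Gaussian periods `ζ + ζ⁵ + ζ⁸ + ζ¹²`, `ζ² + ζ³ + ζ¹⁰ + ζ¹¹`, `ζ⁴ + ζ⁶ + ζ⁷ + ζ⁹`; `f(-X)` is Shanks'
simplest cubic `X³ - X² - 4X - 1`). Everything is PROVED:

* `cubicPoly`, `K`, `θ`: `f` is irreducible (no root mod `2`), `K = AdjoinRoot f` is a number field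
  of degree `3` (`finrank_K`), `θ³ = -θ² + 4θ - 1`, `minpoly θ = f`, `N(θ) = -1` (`norm_θ`).
* `norm_quadratic`: the norm form `N(aθ² + bθ + c)` as the determinant of the multiplication matrix
  on `1, θ, θ²` (`leftMulMatrix_mk`); `discr_pbθ : disc(1, θ, θ²) = 169` (`= -N(f'(θ))`).
* **`𝓞 K = ℤ[θ]`, `d_K = 169 = 13²`** (`isIntegralClosure_adjoin_θ`, `mem_adjoin_θ`,
  `adjoin_θint_eq_top`, `exponent_θint = 1`, `discr_eq`): by the tree's discriminant criterion
  `Literature.NumberTheory.NumberFields.isUnit_indexDet_of_discr_eq` (Marcus, Ch. 2, Ex. 27: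
  `169 = [𝓞_K : ℤ[θ]]² d_K` with `|d_K| > 2` forces index `1`).
* **Units**: `unitθ = θ` (`θ(4 - θ - θ²) = 1`), `unitθ₁ = θ - 1` (`(θ-1)(θ² + 2θ - 2) = 1`).
* **`Gal(K/ℚ) = ⟨σ⟩ ≅ C₃`**: `σ θ = 2 - 2θ - θ²` (`aeval_σθ`: `f(2 - 2X - X²) = -f·(X³ + 5X² + 4X - 5)`),
  `σ²θ = θ² + θ - 3`, `σ³ = 1`, `|Gal(K/ℚ)| = 3` (`card_gal`), `IsGalois ℚ K`, `gal_cases`, and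
  `N(x) = x·σx·σ²x` (`norm_eq_mul_σ_mul_σσ`).
* **Real embeddings** `e₁, e₂, e₃ : K → ℝ`, `θ ↦ r₁ ∈ (-3,-2), r₂ ∈ (0,1), r₃ ∈ (1,2)` (IVT), and
  the sign vectors `sgn(θ) = (-,+,+)`, `sgn(θ-1) = (-,-,+)`, `sgn(-1) = (-,-,-)`.
* **`(𝓞 K)ˣ/(𝓞 K)ˣ² ≅ {±1}³` by real signs, with representatives `±θ^i(θ-1)^j`**
  (`exists_sq_eq_of_sgn_eq_one`: a totally positive unit is a square; `exists_eq_rep_mul_sq`: every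
  unit is `rep a i j · η²`; `exists_sq_eq_of_pos`): Dirichlet's unit theorem in Mathlib's form
  (`NumberField.Units.exist_unique_eq_mul_prod`, `rank K ≤ 2`, torsion `±1`) gives at most `8`
  classes, and the eight sign vectors of `±θ^i(θ-1)^j` exhaust `{±1}³` (the argument of the tree's
  `Literature.Topology.FourManifolds.CappellShanesonClassNumberTwoUnits`, with real signs in place
  of residue symbols).

What is NOT here (sibling files): class number one (Minkowski bound `(2/9)√169 < 3`, `2` inert),
the decomposition of `2, 3` (inert), `5 = 𝔭₁𝔭₂𝔭₃` (`π₁ = θ + 1`), `13 = 𝔭³`, and the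
identification with the cubic subfield of `ℚ(ζ₁₃) ⊂ ℚ(ζ₁₃₃₉)` through the period `ζ + ζ⁵ + ζ⁸ + ζ¹²`.

## References

* D. Shanks, *The simplest cubic fields*, Math. Comp. 28 (1974) 1137–1152 (the family
  `X³ - aX² - (a+3)X - 1`, `a = 1`: conductor `13`, units `ρ, ρ + 1`). [folklore]
* D. A. Marcus, *Number Fields*, 2nd ed. (2018), Ch. 2, Exercise 27 (discriminant criterion for a
  power integral basis); Ch. 5, Thm. 38 (Dirichlet). [cite: Marcus2018, Ch. 2, Exercise 27(d),(e)]
* T. Dokchitser, V. Dokchitser, J. Number Theory 131 (2011) 1833–1839, proof of Thm. 2.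
  [DokchitserDokchitser2011RankModN]

## Design notes

Modelled on the tree's `Literature/NumberTheory/LFunctions/CubeRootTwoField.lean` (`ℚ(2^{1/3})`)
and `Literature/Topology/FourManifolds/CappellShanesonClassNumber*.lean` (cubic fields
`ℤ[X]/(f_a)`): `K` is `AdjoinRoot` of the `ℚ`-polynomial, `θ = AdjoinRoot.root`, integers via
`IntegralBasisCriterion.lean`. Grouping namespace `Literature.NumberTheory.NumberFields.CyclicCubic13`
(named after the object). Rewriting with `cubicPolyRat_eq` is avoided in goals over `K` (the field
instance depends on `cubicPolyRat` through `Fact (Irreducible _)`); identities in `θ` are reduced by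
hand with `θ_pow_three`, `θ_pow_four`.
-/

noncomputable section

open Polynomial NumberField Algebra

namespace Literature.NumberTheory.NumberFields

namespace CyclicCubic13

/-! ### The polynomial `f = X³ + X² - 4X + 1` -/

/-- `f = X³ + X² - 4X + 1 ∈ ℤ[X]`, the defining polynomial of the cubic subfield of `ℚ(ζ₁₃)`
(the minimal polynomial of the Gaussian period `ζ + ζ⁵ + ζ⁸ + ζ¹²`, `ζ = e^{2πi/13}`; under
`X ↦ -X` it is Shanks' simplest cubic `X³ - X² - 4X - 1`). [folklore] -/
abbrev cubicPoly : ℤ[X] := X ^ 3 + X ^ 2 - C 4 * X + C 1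

/-- `f ∈ ℚ[X]` (base change of `cubicPoly`). [folklore] -/
abbrev cubicPolyRat : ℚ[X] := cubicPoly.map (algebraMap ℤ ℚ)

/-- `cubicPolyRat = X³ + X² - 4X + 1`. [folklore] -/
theorem cubicPolyRat_eq : cubicPolyRat = X ^ 3 + X ^ 2 - C 4 * X + C 1 := by
  rw [cubicPolyRat, cubicPoly, Polynomial.map_add, Polynomial.map_sub, Polynomial.map_add,
    Polynomial.map_pow, Polynomial.map_pow, map_X, Polynomial.map_mul, Polynomial.map_C,
    Polynomial.map_C, map_X]
  norm_num

/-- `f` is monic. [folklore] -/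
theorem cubicPoly_monic : cubicPoly.Monic := by
  unfold cubicPoly
  monicity!

/-- `deg f = 3`. [folklore] -/
theorem cubicPoly_natDegree : cubicPoly.natDegree = 3 := by
  unfold cubicPoly
  compute_degree!

/-- `f mod 2 = X³ + X² + 1` has no root in `𝔽₂`, hence is irreducible (a cubic). [folklore] -/
theorem irreducible_map_zmod_two : Irreducible (cubicPoly.map (Int.castRingHom (ZMod 2))) := by
  refine irreducible_of_degree_le_three_of_not_isRoot ?_ fun x => ?_
  · rw [cubicPoly_monic.natDegree_map, cubicPoly_natDegree]
    decide
  · fin_cases x <;>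
      simp only [cubicPoly, Polynomial.map_add, Polynomial.map_sub, Polynomial.map_pow, map_X,
        Polynomial.map_mul, Polynomial.map_C, IsRoot.def, eval_add, eval_sub, eval_mul, eval_pow,
        eval_X, eval_C] <;>
      decide

/-- `f` is irreducible over `ℤ` (it is irreducible modulo `2`). [folklore] -/
theorem cubicPoly_irreducible : Irreducible cubicPoly :=
  cubicPoly_monic.irreducible_of_irreducible_map _ _ irreducible_map_zmod_two

/-- `f` is irreducible over `ℚ` (Gauss). [folklore] -/
theorem cubicPolyRat_irreducible : Irreducible cubicPolyRat :=
  cubicPoly_monic.irreducible_iff_irreducible_map_fraction_map.mp cubicPoly_irreducible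

/-- Irreducibility of `f` over `ℚ` as a `Fact`, so that `AdjoinRoot cubicPolyRat` is a field.
[folklore] -/
instance : Fact (Irreducible cubicPolyRat) := ⟨cubicPolyRat_irreducible⟩

/-- `f ≠ 0` in `ℚ[X]`. [folklore] -/
theorem cubicPolyRat_ne_zero : cubicPolyRat ≠ 0 := cubicPolyRat_irreducible.ne_zero

/-- `cubicPolyRat` is monic. [folklore] -/
theorem cubicPolyRat_monic : cubicPolyRat.Monic := cubicPoly_monic.map _

/-- `deg cubicPolyRat = 3`. [folklore] -/
theorem cubicPolyRat_natDegree : cubicPolyRat.natDegree = 3 := by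
  show (cubicPoly.map (algebraMap ℤ ℚ)).natDegree = 3
  rw [cubicPoly_monic.natDegree_map, cubicPoly_natDegree]

/-! ### The field `K = ℚ[X]/(f)` and its generator `θ` -/

/-- **The cyclic cubic field of conductor `13`**, `K = ℚ[X]/(X³ + X² - 4X + 1)`. [folklore] -/
abbrev K : Type := AdjoinRoot cubicPolyRat

/-- `K` is a number field. [folklore] -/
instance : NumberField K := by unfold K; infer_instance

/-- `θ ∈ K`, the class of `X`. [folklore] -/
def θ : K := AdjoinRoot.root cubicPolyRat

/-- The cubic relation `θ³ = -θ² + 4θ - 1`. [folklore] -/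
theorem θ_pow_three : θ ^ 3 = -θ ^ 2 + 4 * θ - 1 := by
  have h : eval₂ (AdjoinRoot.of cubicPolyRat) (AdjoinRoot.root cubicPolyRat) cubicPolyRat = 0 :=
    AdjoinRoot.eval₂_root cubicPolyRat
  rw [eval₂_map, cubicPoly, eval₂_add, eval₂_sub, eval₂_add, eval₂_X_pow, eval₂_X_pow, eval₂_mul,
    eval₂_C, eval₂_X, eval₂_C, map_ofNat, map_one] at h
  change θ ^ 3 + θ ^ 2 - 4 * θ + 1 = 0 at h
  linear_combination h

/-- `θ` is a root of `f ∈ ℤ[X]`. [folklore] -/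
theorem aeval_θ_cubicPoly : aeval θ cubicPoly = 0 := by
  rw [cubicPoly, map_add, map_sub, map_add, map_pow, map_pow, map_mul, aeval_C, aeval_X, aeval_C,
    map_ofNat, map_one, θ_pow_three]
  ring

/-- `θ` is a root of `f ∈ ℚ[X]`. [folklore] -/
theorem aeval_θ : aeval θ cubicPolyRat = 0 :=
  (aeval_map_algebraMap ℚ θ cubicPoly).trans aeval_θ_cubicPoly

/-- `θ` is an algebraic integer. [folklore] -/
theorem isIntegral_θ : IsIntegral ℤ θ := ⟨cubicPoly, cubicPoly_monic, aeval_θ_cubicPoly⟩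

/-- `minpoly_ℤ θ = f`. [folklore] -/
theorem minpoly_int_θ : minpoly ℤ θ = cubicPoly :=
  (eq_of_monic_of_associated (minpoly.monic isIntegral_θ) cubicPoly_monic
    ((minpoly.irreducible isIntegral_θ).associated_of_dvd cubicPoly_irreducible
      (minpoly.isIntegrallyClosed_dvd isIntegral_θ aeval_θ_cubicPoly)))

/-- `minpoly_ℚ θ = f`. [folklore] -/
theorem minpoly_rat_θ : minpoly ℚ θ = X ^ 3 + X ^ 2 - C 4 * X + C 1 := by
  rw [minpoly.isIntegrallyClosed_eq_field_fractions' ℚ isIntegral_θ, minpoly_int_θ]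
  exact cubicPolyRat_eq

/-- The power basis `1, θ, θ²` of `K/ℚ`. [folklore] -/
def pbθ : PowerBasis ℚ K := AdjoinRoot.powerBasis cubicPolyRat_ne_zero

/-- The generator of `pbθ` is `θ`. [folklore] -/
theorem pbθ_gen : pbθ.gen = θ := AdjoinRoot.powerBasis_gen _

/-- `pbθ` has dimension `3`. [folklore] -/
theorem pbθ_dim : pbθ.dim = 3 := by
  rw [pbθ, AdjoinRoot.powerBasis_dim, cubicPolyRat_natDegree]

/-- `[K : ℚ] = 3`. [folklore] -/
theorem finrank_K : Module.finrank ℚ K = 3 := by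
  rw [← pbθ_dim, PowerBasis.finrank]

/-- `N_{K/ℚ}(θ) = -1` (`= (-1)³ f(0)`); in particular `θ` is a unit. [folklore] -/
theorem norm_θ : Algebra.norm ℚ θ = -1 := by
  have h := PowerBasis.norm_gen_eq_coeff_zero_minpoly pbθ
  rw [pbθ_gen, pbθ_dim, minpoly_rat_θ] at h
  rw [h]
  norm_num [coeff_X_pow, coeff_C, coeff_X]

/-- `θ` is a unit of `K`: `θ · (4 - θ - θ²) = 1`. [folklore] -/
theorem θ_mul_inv : θ * (4 - θ - θ ^ 2) = 1 := by
  linear_combination (-1 : K) * θ_pow_three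

/-- `θ - 1` is a unit: `(θ - 1)(θ² + 2θ - 2) = 1` (`N(θ - 1) = -f(1) = 1`). [folklore] -/
theorem θ_sub_one_mul_inv : (θ - 1) * (θ ^ 2 + 2 * θ - 2) = 1 := by
  linear_combination θ_pow_three


/-! ### Norms of explicit elements: the matrix of multiplication on `1, θ, θ²` -/

/-- `deg_ℚ f = 3` as a `degree`. [folklore] -/
theorem cubicPolyRat_degree : cubicPolyRat.degree = 3 := by
  rw [degree_eq_natDegree cubicPolyRat_ne_zero, cubicPolyRat_natDegree]; rfl

/-- The power basis `1, θ, θ²` in Mathlib's `powerBasis'` form (coordinates = coefficients of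
remainders modulo `f`). [folklore] -/
abbrev pbX : PowerBasis ℚ K := AdjoinRoot.powerBasis' cubicPolyRat_monic

/-- `pbX` has dimension `3`. [folklore] -/
theorem pbX_dim : pbX.dim = 3 := cubicPolyRat_natDegree

/-- Coordinates in `pbX`: the class of `p` has as coordinates the coefficients of `p mod f`.
[folklore] -/
theorem repr_mk (p : ℚ[X]) (i : Fin pbX.dim) :
    pbX.basis.repr (AdjoinRoot.mk cubicPolyRat p) i = (p %ₘ cubicPolyRat).coeff i := by
  change (AdjoinRoot.powerBasisAux' cubicPolyRat_monic).repr _ i = _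
  rw [AdjoinRoot.powerBasisAux'_repr_apply_to_fun, AdjoinRoot.modByMonicHom_mk]

/-- Entries of the matrix of multiplication by the class of `p` on `1, θ, θ²`: the `(i, j)` entry
is the `i`-th coefficient of `p·X^j mod f`. [folklore] -/
theorem leftMulMatrix_mk (p : ℚ[X]) (i j : Fin pbX.dim) :
    Algebra.leftMulMatrix pbX.basis (AdjoinRoot.mk cubicPolyRat p) i j =
      ((p * X ^ (j : ℕ)) %ₘ cubicPolyRat).coeff i := by
  rw [Algebra.leftMulMatrix_eq_repr_mul, PowerBasis.basis_eq_pow,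
    show pbX.gen = AdjoinRoot.mk cubicPolyRat X from (AdjoinRoot.mk_X).symm, ← map_pow, ← map_mul,
    repr_mk]

/-- Reduction of a polynomial modulo `f` to an explicit quadratic remainder, certified by the
quotient `k`. [folklore] -/
theorem modByMonic_cubicPolyRat_eq {q : ℚ[X]} (a b c : ℚ) (k : ℚ[X])
    (h : q - (C a * X ^ 2 + C b * X + C c) = cubicPolyRat * k) :
    q %ₘ cubicPolyRat = C a * X ^ 2 + C b * X + C c := by
  rw [modByMonic_eq_of_dvd_sub cubicPolyRat_monic (Dvd.intro _ h.symm),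
    modByMonic_eq_self_iff cubicPolyRat_monic, cubicPolyRat_degree]
  exact degree_quadratic_le.trans_lt (by decide)

/-- **`N(aθ² + bθ + c) = det` of the multiplication matrix** on `1, θ, θ²`, whose columns are the
remainders of `p, pX, pX²` modulo `f` (`p = aX² + bX + c`): with `θ³ = -θ² + 4θ - 1` and
`θ⁴ = 5θ² - 5θ + 1` these are `(c, b, a)`, `(-a, c + 4a, b - a)`, `(a - b, 4b - 5a, c - b + 5a)`.
[folklore] -/
theorem norm_mk_eq (a b c : ℚ) :
    Algebra.norm ℚ (AdjoinRoot.mk cubicPolyRat (C a * X ^ 2 + C b * X + C c)) =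
      c * ((c + 4 * a) * (c - b + 5 * a) - (4 * b - 5 * a) * (b - a))
        - (-a) * (b * (c - b + 5 * a) - (4 * b - 5 * a) * a)
        + (a - b) * (b * (b - a) - (c + 4 * a) * a) := by
  classical
  set p : ℚ[X] := C a * X ^ 2 + C b * X + C c with hp
  have h4 : (C 4 : ℚ[X]) = 4 := map_ofNat C 4
  have h5 : (C 5 : ℚ[X]) = 5 := map_ofNat C 5
  have r0 : p %ₘ cubicPolyRat = C a * X ^ 2 + C b * X + C c :=
    modByMonic_cubicPolyRat_eq a b c 0 (by rw [hp]; ring)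
  have r1 : (p * X) %ₘ cubicPolyRat = C (b - a) * X ^ 2 + C (c + 4 * a) * X + C (-a) :=
    modByMonic_cubicPolyRat_eq _ _ _ (C a) (by
      rw [hp, cubicPolyRat_eq]; simp only [C_sub, C_add, C_mul, C_neg, h4, C_1]; ring)
  have r2 : (p * X ^ 2) %ₘ cubicPolyRat =
      C (c - b + 5 * a) * X ^ 2 + C (4 * b - 5 * a) * X + C (a - b) :=
    modByMonic_cubicPolyRat_eq _ _ _ (C a * X + C (b - a)) (by
      rw [hp, cubicPolyRat_eq]; simp only [C_sub, C_add, C_mul, h4, h5, C_1]; ring)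
  set e := finCongr pbX_dim with he
  have hv : ∀ j : Fin 3, ((e.symm j : Fin pbX.dim) : ℕ) = (j : ℕ) := fun j => rfl
  have hent : ∀ i j : Fin 3,
      Algebra.leftMulMatrix (pbX.basis.reindex e) (AdjoinRoot.mk cubicPolyRat p) i j =
        ((p * X ^ (j : ℕ)) %ₘ cubicPolyRat).coeff (i : ℕ) := by
    intro i j
    rw [Algebra.leftMulMatrix_eq_repr_mul, Module.Basis.reindex_apply,
      Module.Basis.repr_reindex_apply, ← Algebra.leftMulMatrix_eq_repr_mul, leftMulMatrix_mk,
      hv, hv]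
  have hdet := Algebra.norm_eq_matrix_det (pbX.basis.reindex e) (AdjoinRoot.mk cubicPolyRat p)
  rw [Matrix.det_fin_three] at hdet
  simp only [hent, Fin.val_zero, Fin.val_one, Fin.val_two, pow_zero, mul_one, pow_one, r0, r1,
    r2, coeff_add, coeff_C_mul, coeff_X_pow, coeff_X, coeff_C] at hdet
  norm_num at hdet
  rw [hdet]
  ring

/-- The class of `aX² + bX + c` is `aθ² + bθ + c`. [folklore] -/
theorem mk_quadratic (a b c : ℚ) :
    AdjoinRoot.mk cubicPolyRat (C a * X ^ 2 + C b * X + C c) = (a : K) * θ ^ 2 + (b : K) * θ + c := by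
  rw [map_add, map_add, map_mul, map_mul, map_pow, AdjoinRoot.mk_C, AdjoinRoot.mk_C,
    AdjoinRoot.mk_C, AdjoinRoot.mk_X, eq_ratCast, eq_ratCast, eq_ratCast]
  rfl

/-- **The norm form of `K` on `1, θ, θ²`**: `N(aθ² + bθ + c)` as an explicit cubic form in
`a, b, c` (determinant of the multiplication matrix, `norm_mk_eq`). [folklore] -/
theorem norm_quadratic (a b c : ℚ) :
    Algebra.norm ℚ ((a : K) * θ ^ 2 + (b : K) * θ + c) =
      c * ((c + 4 * a) * (c - b + 5 * a) - (4 * b - 5 * a) * (b - a))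
        - (-a) * (b * (c - b + 5 * a) - (4 * b - 5 * a) * a)
        + (a - b) * (b * (b - a) - (c + 4 * a) * a) := by
  rw [← mk_quadratic, norm_mk_eq]

/-- `f'(θ) = 3θ² + 2θ - 4`. [folklore] -/
theorem aeval_derivative_minpoly :
    aeval θ (derivative (minpoly ℚ θ)) = ((3 : ℚ) : K) * θ ^ 2 + ((2 : ℚ) : K) * θ + ((-4 : ℚ) : K) := by
  rw [minpoly_rat_θ]
  simp only [map_add, map_sub, derivative_X_pow, derivative_mul, derivative_C, derivative_X,
    zero_mul, zero_add, mul_one, add_zero, map_mul, map_pow, aeval_X, aeval_C, eq_ratCast,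
    Rat.cast_ofNat, Rat.cast_neg, Nat.cast_ofNat]
  ring

/-- `f'(θ) = 3θ² + 2θ - 4` has norm `-169`. [folklore] -/
theorem norm_aeval_derivative : Algebra.norm ℚ (aeval θ (derivative (minpoly ℚ θ))) = -169 := by
  rw [aeval_derivative_minpoly, norm_quadratic]
  norm_num

/-- **`disc(1, θ, θ²) = 169 = 13²`** (the discriminant of `X³ + X² - 4X + 1`). [folklore] -/
theorem discr_pbθ : Algebra.discr ℚ pbθ.basis = 169 := by
  rw [Algebra.discr_powerBasis_eq_norm, finrank_K, pbθ_gen, norm_aeval_derivative]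
  norm_num


/-! ### `𝓞 K = ℤ[θ]`, `d_K = 169` -/

/-- The arithmetic input of Marcus' criterion for `d = 169 = 13²`: a factorisation
`169 = r² e` with `|e| > 2` has `r = ±1` (`r ∣ 13`, and `r = ±13` would give `e = 1`). [folklore] -/
theorem isUnit_of_sq_mul_eq_169 (r e : ℤ) (h : (169 : ℤ) = r ^ 2 * e) (he : 2 < |e|) : IsUnit r := by
  have hr0 : r ≠ 0 := by rintro rfl; norm_num at h
  have hdvd : r.natAbs ^ 2 ∣ 13 ^ 2 := by
    have : (r ^ 2).natAbs ∣ (169 : ℤ).natAbs := Int.natAbs_dvd_natAbs.mpr ⟨e, h⟩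
    simpa [Int.natAbs_pow] using this
  have hr : r.natAbs ∣ 13 := (Nat.pow_dvd_pow_iff two_ne_zero).mp hdvd
  rcases (Nat.dvd_prime (by decide : Nat.Prime 13)).mp hr with h1 | h13
  · exact Int.isUnit_iff_natAbs_eq.mpr h1
  · exfalso
    have hr2 : r ^ 2 = 169 := by
      have : (r.natAbs : ℤ) ^ 2 = 169 := by rw [h13]; norm_num
      rwa [Int.natAbs_sq] at this
    rw [hr2] at h
    have he1 : e = 1 := by nlinarith
    rw [he1] at he
    norm_num at he

/-- `θ` (as the generator of `pbθ`) is integral. [folklore] -/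
theorem isIntegral_pbθ_gen : IsIntegral ℤ pbθ.gen := by rw [pbθ_gen]; exact isIntegral_θ

/-- The index determinant of `1, θ, θ²` in an integral basis is a unit, i.e. **`1, θ, θ²` is an
integral basis** (Marcus, Ch. 2, Ex. 27: `disc(1, θ, θ²) = 169 = [𝓞_K : ℤ[θ]]² d_K` with
`|d_K| > 2`). [folklore] -/
theorem isUnit_indexDet : IsUnit (indexDet pbθ isIntegral_pbθ_gen) :=
  isUnit_indexDet_of_discr_eq pbθ isIntegral_pbθ_gen (by rw [finrank_K]; norm_num) 169
    discr_pbθ isUnit_of_sq_mul_eq_169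

/-- **`d_K = 169 = 13²`.** [folklore] -/
theorem discr_eq : NumberField.discr K = 169 :=
  discr_eq_of_isUnit_indexDet pbθ isIntegral_pbθ_gen isUnit_indexDet 169 discr_pbθ

/-- **`𝓞 K = ℤ[θ]`**: `ℤ[θ]` is the integral closure of `ℤ` in `K`. [folklore] -/
theorem isIntegralClosure_adjoin_θ : IsIntegralClosure (Algebra.adjoin ℤ ({θ} : Set K)) ℤ K := by
  have h := isIntegralClosure_adjoin_of_isUnit_indexDet pbθ isIntegral_pbθ_gen isUnit_indexDet
  rwa [pbθ_gen] at h

/-- Every algebraic integer of `K` lies in `ℤ[θ]`. [folklore] -/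
theorem mem_adjoin_θ (x : 𝓞 K) : (x : K) ∈ Algebra.adjoin ℤ ({θ} : Set K) := by
  have h := mem_adjoin_of_isUnit_indexDet pbθ isIntegral_pbθ_gen isUnit_indexDet x
  rwa [pbθ_gen] at h

/-- `θ` as an element of `𝓞 K`. [folklore] -/
def θint : 𝓞 K := ⟨θ, isIntegral_θ⟩

/-- The coercion of `θint` to `K` is `θ`. [folklore] -/
@[simp] theorem coe_θint : ((θint : 𝓞 K) : K) = θ := rfl

/-- `ℤ[θ] = 𝓞 K`, as subalgebras of `𝓞 K`. [folklore] -/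
theorem adjoin_θint_eq_top : Algebra.adjoin ℤ ({θint} : Set (𝓞 K)) = ⊤ := by
  refine Algebra.eq_top_iff.2 fun b => ?_
  apply Literature.NumberTheory.LFunctions.DegreeOnePrimes.mem_adjoin_of_coe_mem_adjoin
  rw [coe_θint]
  exact mem_adjoin_θ b

/-- The Dedekind–Kummer exponent of `θ` is `1` (trivial conductor), so Dedekind's factorisation
theorem applies at every prime. [folklore] -/
theorem exponent_θint : RingOfIntegers.exponent θint = 1 :=
  RingOfIntegers.exponent_eq_one_iff.mpr adjoin_θint_eq_top

/-- `minpoly_ℤ θint = f`. [folklore] -/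
theorem minpoly_θint : minpoly ℤ θint = cubicPoly := by
  rw [← RingOfIntegers.minpoly_coe, coe_θint]
  convert minpoly_int_θ
  exact Subsingleton.elim _ _

/-- The cubic relation in `𝓞 K`: `θ³ + θ² - 4θ + 1 = 0`. [folklore] -/
theorem θint_rel : (θint : 𝓞 K) ^ 3 + θint ^ 2 - 4 * θint + 1 = 0 := by
  apply RingOfIntegers.coe_injective
  simp only [map_add, map_sub, map_mul, map_pow, map_one, map_zero, coe_θint, map_ofNat]
  rw [θ_pow_three]
  ring

/-! ### The units `θ` and `θ - 1` -/

/-- **The unit `θ`** of `𝓞 K` (`N(θ) = -1`), with inverse `4 - θ - θ²`. [folklore] -/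
def unitθ : (𝓞 K)ˣ :=
  Units.mkOfMulEqOne θint (4 - θint - θint ^ 2) (by linear_combination (-1 : 𝓞 K) * θint_rel)

/-- **The unit `θ - 1`** of `𝓞 K` (`N(θ - 1) = 1`), with inverse `θ² + 2θ - 2`. [folklore] -/
def unitθ₁ : (𝓞 K)ˣ :=
  Units.mkOfMulEqOne (θint - 1) (θint ^ 2 + 2 * θint - 2) (by linear_combination θint_rel)

/-- The underlying element of `unitθ` is `θ`. [folklore] -/
@[simp] theorem coe_unitθ : ((unitθ : (𝓞 K)ˣ) : 𝓞 K) = θint := rfl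

/-- The underlying element of `unitθ₁` is `θ - 1`. [folklore] -/
@[simp] theorem coe_unitθ₁ : ((unitθ₁ : (𝓞 K)ˣ) : 𝓞 K) = θint - 1 := rfl

/-! ### The automorphism `σ : θ ↦ 2 - 2θ - θ²` of order `3`; `K/ℚ` is Galois -/

/-- `s(θ) = 2 - 2θ - θ²` is again a root of `f`: `f(2 - 2X - X²) = -f(X)·(X³ + 5X² + 4X - 5)`.
(With `θ = ζ + ζ⁵ + ζ⁸ + ζ¹²`, `ζ = e^{2πi/13}`, this is the period `ζ² + ζ³ + ζ¹⁰ + ζ¹¹`, the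
image of `θ` under `ζ ↦ ζ²`.) [folklore] -/
theorem aeval_σθ : aeval (2 - 2 * θ - θ ^ 2) cubicPolyRat = 0 := by
  have h3 := θ_pow_three
  have h4 : θ ^ 4 = 5 * θ ^ 2 - 5 * θ + 1 := by
    calc θ ^ 4 = θ * θ ^ 3 := by ring
      _ = _ := by rw [h3]; ring_nf; rw [h3]; ring
  have h5 : θ ^ 5 = -10 * θ ^ 2 + 21 * θ - 5 := by
    calc θ ^ 5 = θ * θ ^ 4 := by ring
      _ = _ := by rw [h4]; ring_nf; rw [h3]; ring
  have h6 : θ ^ 6 = 31 * θ ^ 2 - 45 * θ + 10 := by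
    calc θ ^ 6 = θ * θ ^ 5 := by ring
      _ = _ := by rw [h5]; ring_nf; rw [h3]; ring
  refine (aeval_map_algebraMap ℚ _ cubicPoly).trans ?_
  rw [cubicPoly, map_add, map_sub, map_add, map_pow, map_pow, map_mul, aeval_C, aeval_X, aeval_C,
    map_ofNat, map_one]
  ring_nf
  rw [h6, h5, h4, h3]
  ring

/-- The `ℚ`-algebra endomorphism of `K` sending `θ ↦ 2 - 2θ - θ²`. [folklore] -/
def σHom : K →ₐ[ℚ] K :=
  AdjoinRoot.liftAlgHom cubicPolyRat (Algebra.ofId ℚ K) (2 - 2 * θ - θ ^ 2) aeval_σθ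

/-- `σHom θ = 2 - 2θ - θ²`. [folklore] -/
theorem σHom_θ : σHom θ = 2 - 2 * θ - θ ^ 2 := AdjoinRoot.liftAlgHom_root _ _ _ _

/-- **The automorphism `σ` of `K/ℚ`**, `σ(θ) = 2 - 2θ - θ²` (`σHom` is bijective: an injective
endomorphism of a finite-dimensional space). [folklore] -/
def σ : K ≃ₐ[ℚ] K :=
  AlgEquiv.ofBijective σHom ⟨(σHom : K →+* K).injective,
    LinearMap.surjective_of_injective (f := σHom.toLinearMap) (σHom : K →+* K).injective⟩

/-- `σ θ = 2 - 2θ - θ²`. [folklore] -/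
theorem σ_θ : σ θ = 2 - 2 * θ - θ ^ 2 := σHom_θ

/-- `θ⁴ = 5θ² - 5θ + 1`. [folklore] -/
theorem θ_pow_four : θ ^ 4 = 5 * θ ^ 2 - 5 * θ + 1 := by
  have h3 := θ_pow_three
  calc θ ^ 4 = θ * θ ^ 3 := by ring
    _ = _ := by rw [h3]; ring_nf; rw [h3]; ring

/-- `σ² θ = θ² + θ - 3` (the third period `ζ⁴ + ζ⁶ + ζ⁷ + ζ⁹`). [folklore] -/
theorem σ_σ_θ : σ (σ θ) = θ ^ 2 + θ - 3 := by
  rw [σ_θ, map_sub, map_sub, map_mul, map_pow, σ_θ, map_ofNat]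
  ring_nf
  rw [θ_pow_four, θ_pow_three]
  ring

/-- `σ³ = 1`: `σ(θ² + θ - 3) = θ`. [folklore] -/
theorem σ_σ_σ_θ : σ (σ (σ θ)) = θ := by
  rw [σ_σ_θ, map_sub, map_add, map_pow, σ_θ, map_ofNat]
  ring_nf
  rw [θ_pow_four, θ_pow_three]
  ring

/-- A `ℚ`-algebra endomorphism of `K = ℚ(θ)` is determined by the image of `θ`. [folklore] -/
theorem algEquiv_eq_of_apply_θ {g h : K ≃ₐ[ℚ] K} (hgh : g θ = h θ) : g = h := by
  apply AlgEquiv.coe_toAlgHom_injective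
  refine AdjoinRoot.algHom_ext ?_
  change g θ = h θ
  exact hgh

/-- `σ³ = 1` in `Gal(K/ℚ)`. [folklore] -/
theorem σ_pow_three : σ ^ 3 = 1 :=
  algEquiv_eq_of_apply_θ (by rw [pow_three, AlgEquiv.mul_apply, AlgEquiv.mul_apply, σ_σ_σ_θ]; rfl)

/-- A non-zero polynomial of degree `≤ 2` does not vanish at `θ` (`f` is the minimal polynomial).
[folklore] -/
theorem quadratic_ne_zero {a b c : ℚ} (h : (a, b, c) ≠ (0, 0, 0)) :
    (a : K) * θ ^ 2 + (b : K) * θ + c ≠ 0 := by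
  rw [← mk_quadratic, Ne, AdjoinRoot.mk_eq_zero]
  intro hdvd
  have hq0 : (C a * X ^ 2 + C b * X + C c : ℚ[X]) ≠ 0 := by
    intro h0
    apply h
    have ha : a = 0 := by simpa using congrArg (coeff · 2) h0
    have hb : b = 0 := by simpa [ha] using congrArg (coeff · 1) h0
    have hc : c = 0 := by simpa [ha, hb] using congrArg (coeff · 0) h0
    rw [ha, hb, hc]
  have hdeg := degree_le_of_dvd hdvd hq0
  rw [cubicPolyRat_degree] at hdeg
  exact absurd (hdeg.trans degree_quadratic_le) (by decide)

/-- `σ ≠ 1` (`σ θ = θ` would mean `θ² + 3θ - 2 = 0`). [folklore] -/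
theorem σ_ne_one : σ ≠ 1 := by
  intro h
  have e : σ θ = θ := by rw [h]; rfl
  rw [σ_θ] at e
  have : ((-1 : ℚ) : K) * θ ^ 2 + ((-3 : ℚ) : K) * θ + ((2 : ℚ) : K) = 0 := by
    push_cast; linear_combination e
  exact quadratic_ne_zero (by norm_num) this

/-- `σ² ≠ 1` (`σ² θ = θ` would mean `θ² = 3`). [folklore] -/
theorem σ_sq_ne_one : σ ^ 2 ≠ 1 := by
  intro h
  have e : σ (σ θ) = θ := by rw [← AlgEquiv.mul_apply, ← pow_two, h]; rfl
  rw [σ_σ_θ] at e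
  have : ((1 : ℚ) : K) * θ ^ 2 + ((0 : ℚ) : K) * θ + ((-3 : ℚ) : K) = 0 := by
    push_cast; linear_combination e
  exact quadratic_ne_zero (by norm_num) this

/-- `σ² ≠ σ`. [folklore] -/
theorem σ_sq_ne_σ : σ ^ 2 ≠ σ := fun h => σ_ne_one (by
  have := congrArg (· * σ⁻¹) h
  simpa [pow_two, mul_assoc] using this)

/-- **`|Gal(K/ℚ)| = 3`**: `1, σ, σ²` are distinct and `|Aut_ℚ(K)| ≤ [K : ℚ] = 3`. [folklore] -/
theorem card_gal : Nat.card (K ≃ₐ[ℚ] K) = 3 := by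
  classical
  rw [Nat.card_eq_fintype_card]
  refine le_antisymm (finrank_K ▸ AlgEquiv.card_le) ?_
  have h3 : ({1, σ, σ ^ 2} : Finset (K ≃ₐ[ℚ] K)).card = 3 := by
    rw [Finset.card_insert_of_notMem, Finset.card_insert_of_notMem, Finset.card_singleton]
    · rw [Finset.mem_singleton]; exact σ_sq_ne_σ.symm
    · rw [Finset.mem_insert, Finset.mem_singleton, not_or]
      exact ⟨σ_ne_one.symm, σ_sq_ne_one.symm⟩
  rw [← h3]
  exact Finset.card_le_univ _

/-- **`K/ℚ` is Galois** (cyclic of degree `3`, `Gal(K/ℚ) = ⟨σ⟩`). [folklore] -/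
instance isGalois : IsGalois ℚ K := IsGalois.of_card_aut_eq_finrank ℚ K (card_gal.trans finrank_K.symm)

/-- Every element of `Gal(K/ℚ)` is `1`, `σ` or `σ²`. [folklore] -/
theorem gal_cases (g : K ≃ₐ[ℚ] K) : g = 1 ∨ g = σ ∨ g = σ ^ 2 := by
  classical
  by_contra h
  simp only [not_or] at h
  have h4 : ({1, σ, σ ^ 2, g} : Finset (K ≃ₐ[ℚ] K)).card = 4 := by
    rw [Finset.card_insert_of_notMem, Finset.card_insert_of_notMem, Finset.card_insert_of_notMem,
      Finset.card_singleton]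
    · rw [Finset.mem_singleton]; exact fun e => h.2.2 e.symm
    · rw [Finset.mem_insert, Finset.mem_singleton, not_or]
      exact ⟨σ_sq_ne_σ.symm, fun e => h.2.1 e.symm⟩
    · rw [Finset.mem_insert, Finset.mem_insert, Finset.mem_singleton, not_or, not_or]
      exact ⟨σ_ne_one.symm, σ_sq_ne_one.symm, fun e => h.1 e.symm⟩
  have hle : ({1, σ, σ ^ 2, g} : Finset (K ≃ₐ[ℚ] K)).card ≤ Fintype.card (K ≃ₐ[ℚ] K) :=
    Finset.card_le_univ _
  rw [h4, ← Nat.card_eq_fintype_card, card_gal] at hle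
  omega

/-- **`N_{K/ℚ}(x) = x · σx · σ²x`** for every `x ∈ K`. [folklore] -/
theorem norm_eq_mul_σ_mul_σσ (x : K) : algebraMap ℚ K (Algebra.norm ℚ x) = x * σ x * σ (σ x) := by
  classical
  rw [Algebra.norm_eq_prod_automorphisms]
  have huniv : (Finset.univ : Finset (K ≃ₐ[ℚ] K)) = {1, σ, σ ^ 2} := by
    ext g
    simp only [Finset.mem_univ, Finset.mem_insert, Finset.mem_singleton, true_iff]
    exact gal_cases g
  rw [huniv, Finset.prod_insert, Finset.prod_insert, Finset.prod_singleton]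
  · rw [pow_two, AlgEquiv.mul_apply, AlgEquiv.one_apply, mul_assoc]
  · rw [Finset.mem_singleton]; exact σ_sq_ne_σ.symm
  · rw [Finset.mem_insert, Finset.mem_singleton, not_or]; exact ⟨σ_ne_one.symm, σ_sq_ne_one.symm⟩


/-! ### The three real embeddings and the signs of `θ`, `θ - 1` -/

/-- The real cubic function `p(x) = x³ + x² - 4x + 1`. [folklore] -/
def preal (x : ℝ) : ℝ := x ^ 3 + x ^ 2 - 4 * x + 1

/-- `p` is continuous. [folklore] -/
theorem continuous_preal : Continuous preal := by unfold preal; fun_prop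

/-- `f` has a real root in each of `(-3, -2)`, `(0, 1)`, `(1, 2)` (sign changes
`p(-3) = -5 < 0 < 5 = p(-2)`, `p(0) = 1 > 0 > -1 = p(1)`, `p(1) = -1 < 0 < 5 = p(2)`). [folklore] -/
theorem exists_roots_preal :
    (∃ r, r ∈ Set.Ioo (-3 : ℝ) (-2) ∧ preal r = 0) ∧ (∃ r, r ∈ Set.Ioo (0 : ℝ) 1 ∧ preal r = 0) ∧
      (∃ r, r ∈ Set.Ioo (1 : ℝ) 2 ∧ preal r = 0) := by
  refine ⟨?_, ?_, ?_⟩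
  · have h := intermediate_value_Ioo (show (-3 : ℝ) ≤ -2 by norm_num) continuous_preal.continuousOn
    have h0 : (0 : ℝ) ∈ Set.Ioo (preal (-3)) (preal (-2)) := by simp only [preal, Set.mem_Ioo]; norm_num
    obtain ⟨r, hr, hr0⟩ := h h0
    exact ⟨r, hr, hr0⟩
  · have h := intermediate_value_Ioo' (show (0 : ℝ) ≤ 1 by norm_num) continuous_preal.continuousOn
    have h0 : (0 : ℝ) ∈ Set.Ioo (preal 1) (preal 0) := by simp only [preal, Set.mem_Ioo]; norm_num
    obtain ⟨r, hr, hr0⟩ := h h0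
    exact ⟨r, hr, hr0⟩
  · have h := intermediate_value_Ioo (show (1 : ℝ) ≤ 2 by norm_num) continuous_preal.continuousOn
    have h0 : (0 : ℝ) ∈ Set.Ioo (preal 1) (preal 2) := by simp only [preal, Set.mem_Ioo]; norm_num
    obtain ⟨r, hr, hr0⟩ := h h0
    exact ⟨r, hr, hr0⟩

/-- The real root `r₁ ∈ (-3, -2)` of `f` (`≈ -2.651`, the period `ζ⁴ + ζ⁶ + ζ⁷ + ζ⁹`). [folklore] -/
def r₁ : ℝ := Classical.choose exists_roots_preal.1
/-- The real root `r₂ ∈ (0, 1)` of `f` (`≈ 0.274`, the period `ζ + ζ⁵ + ζ⁸ + ζ¹²`). [folklore] -/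
def r₂ : ℝ := Classical.choose exists_roots_preal.2.1
/-- The real root `r₃ ∈ (1, 2)` of `f` (`≈ 1.377`, the period `ζ² + ζ³ + ζ¹⁰ + ζ¹¹`). [folklore] -/
def r₃ : ℝ := Classical.choose exists_roots_preal.2.2

/-- `-3 < r₁ < -2` and `p(r₁) = 0`. [folklore] -/
theorem r₁_spec : r₁ ∈ Set.Ioo (-3 : ℝ) (-2) ∧ preal r₁ = 0 := Classical.choose_spec exists_roots_preal.1
/-- `0 < r₂ < 1` and `p(r₂) = 0`. [folklore] -/
theorem r₂_spec : r₂ ∈ Set.Ioo (0 : ℝ) 1 ∧ preal r₂ = 0 := Classical.choose_spec exists_roots_preal.2.1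
/-- `1 < r₃ < 2` and `p(r₃) = 0`. [folklore] -/
theorem r₃_spec : r₃ ∈ Set.Ioo (1 : ℝ) 2 ∧ preal r₃ = 0 := Classical.choose_spec exists_roots_preal.2.2

/-- A real root of `p` is a root of `cubicPolyRat` under `ℚ → ℝ`. [folklore] -/
theorem eval₂_cubicPolyRat_real {r : ℝ} (hr : preal r = 0) :
    cubicPolyRat.eval₂ (algebraMap ℚ ℝ) r = 0 := by
  rw [eval₂_map, cubicPoly, eval₂_add, eval₂_sub, eval₂_add, eval₂_X_pow, eval₂_X_pow, eval₂_mul,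
    eval₂_C, eval₂_X, eval₂_C, map_ofNat, map_one]
  exact hr

/-- **The real embedding `e₁ : K → ℝ`, `θ ↦ r₁`.** [folklore] -/
def e₁ : K →+* ℝ := AdjoinRoot.lift (algebraMap ℚ ℝ) r₁ (eval₂_cubicPolyRat_real r₁_spec.2)
/-- **The real embedding `e₂ : K → ℝ`, `θ ↦ r₂`.** [folklore] -/
def e₂ : K →+* ℝ := AdjoinRoot.lift (algebraMap ℚ ℝ) r₂ (eval₂_cubicPolyRat_real r₂_spec.2)
/-- **The real embedding `e₃ : K → ℝ`, `θ ↦ r₃`.** [folklore] -/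
def e₃ : K →+* ℝ := AdjoinRoot.lift (algebraMap ℚ ℝ) r₃ (eval₂_cubicPolyRat_real r₃_spec.2)

/-- `e₁ θ = r₁`. [folklore] -/
@[simp] theorem e₁_θ : e₁ θ = r₁ := AdjoinRoot.lift_root _
/-- `e₂ θ = r₂`. [folklore] -/
@[simp] theorem e₂_θ : e₂ θ = r₂ := AdjoinRoot.lift_root _
/-- `e₃ θ = r₃`. [folklore] -/
@[simp] theorem e₃_θ : e₃ θ = r₃ := AdjoinRoot.lift_root _

/-- The three real embeddings are pairwise distinct (they separate `θ`). [folklore] -/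
theorem e_ne : e₁ ≠ e₂ ∧ e₁ ≠ e₃ ∧ e₂ ≠ e₃ := by
  have h1 := r₁_spec.1; have h2 := r₂_spec.1; have h3 := r₃_spec.1
  simp only [Set.mem_Ioo] at h1 h2 h3
  refine ⟨fun h => ?_, fun h => ?_, fun h => ?_⟩
  · have := congrArg (· θ) h; simp only [e₁_θ, e₂_θ] at this; linarith
  · have := congrArg (· θ) h; simp only [e₁_θ, e₃_θ] at this; linarith
  · have := congrArg (· θ) h; simp only [e₂_θ, e₃_θ] at this; linarith


/-! ### Units modulo squares: `(𝓞 K)ˣ/(𝓞 K)ˣ² = {±θ^i(θ-1)^j}` via real signs -/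

/-- For a cubic field the unit rank `r₁ + r₂ - 1` is at most `2` (`r₁ + 2r₂ = 3`). (As in the tree's
`Literature.Topology.FourManifolds.units_rank_le_two`.) [folklore] -/
theorem units_rank_le_two : Units.rank K ≤ 2 := by
  have h1 := InfinitePlace.card_add_two_mul_card_eq_rank K
  have h2 := InfinitePlace.card_eq_nrRealPlaces_add_nrComplexPlaces K
  rw [finrank_K] at h1
  rw [Units.rank, h2]
  omega

/-- **Units modulo squares (Dirichlet).** Every unit is `ρ(e) η²` where
`ρ(s, ε) = (-1)^s ∏ᵢ εᵢ^{εᵢ'}` over Mathlib's fundamental system `εᵢ` (`i < rank K`), with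
`s, εᵢ' ∈ {0, 1}` (`NumberField.Units.exist_unique_eq_mul_prod`, torsion `= ±1` in odd degree).
(As in the tree's `Literature.Topology.FourManifolds.exists_rep_mul_sq`.) [folklore] -/
theorem exists_rep_mul_sq (x : (𝓞 K)ˣ) :
    ∃ (s : Fin 2) (ε : Fin (Units.rank K) → Fin 2) (η : (𝓞 K)ˣ),
      x = ((-1) ^ (s : ℕ) * ∏ i, Units.fundSystem K i ^ ((ε i : ℕ))) * η ^ 2 := by
  classical
  obtain ⟨⟨ζ, e⟩, hx, -⟩ := Units.exist_unique_eq_mul_prod K x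
  have hodd : Odd (Module.finrank ℚ K) := by rw [finrank_K]; decide
  refine ⟨if ((ζ : (𝓞 K)ˣ) = 1) then 0 else 1, fun i => ⟨(e i % 2).toNat, by omega⟩,
    ∏ i, Units.fundSystem K i ^ (e i / 2), ?_⟩
  have hsplit : ∀ i, Units.fundSystem K i ^ e i =
      Units.fundSystem K i ^ (((⟨(e i % 2).toNat, by omega⟩ : Fin 2) : ℕ)) *
        (Units.fundSystem K i ^ (e i / 2)) ^ 2 := by
    intro i
    rw [← zpow_natCast, ← zpow_natCast (Units.fundSystem K i ^ (e i / 2)) 2, ← zpow_mul,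
      ← zpow_add]
    congr 1
    push_cast
    rw [Int.toNat_of_nonneg (Int.emod_nonneg _ two_ne_zero)]
    omega
  rw [← Finset.prod_pow, mul_assoc, ← Finset.prod_mul_distrib]
  simp_rw [← hsplit]
  rcases Units.torsion_eq_one_or_neg_one_of_odd_finrank hodd ζ with hζ | hζ
  · rw [if_pos hζ]
    simp only [Fin.val_zero, pow_zero, one_mul]
    rw [hζ, one_mul] at hx
    exact hx
  · have hne : (ζ : (𝓞 K)ˣ) ≠ 1 := by
      rw [hζ]
      intro h
      have h' := congrArg (fun u : (𝓞 K)ˣ => (u : 𝓞 K)) h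
      simp only [Units.val_neg, Units.val_one] at h'
      norm_num at h'
    rw [if_neg hne]
    simp only [Fin.val_one, pow_one]
    rw [hζ] at hx
    exact hx

/-- The **sign vector** of a unit under the three real embeddings. [folklore] -/
def sgn (y : (𝓞 K)ˣ) : SignType × SignType × SignType :=
  (SignType.sign (e₁ ((y : 𝓞 K) : K)), SignType.sign (e₂ ((y : 𝓞 K) : K)),
    SignType.sign (e₃ ((y : 𝓞 K) : K)))

/-- The sign vector is multiplicative. [folklore] -/
theorem sgn_mul (y z : (𝓞 K)ˣ) : sgn (y * z) = sgn y * sgn z := by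
  simp only [sgn, Units.val_mul, map_mul, sign_mul, Prod.mk_mul_mk]

/-- A real embedding does not vanish on units. [folklore] -/
theorem emb_units_ne_zero (e : K →+* ℝ) (y : (𝓞 K)ˣ) : e ((y : 𝓞 K) : K) ≠ 0 :=
  (map_ne_zero e).mpr (RingOfIntegers.coe_ne_zero_iff.mpr (Units.ne_zero y))

/-- Squares of units are totally positive: `sgn (η²) = 1`. [folklore] -/
theorem sgn_sq (η : (𝓞 K)ˣ) : sgn (η ^ 2) = 1 := by
  have h : ∀ e : K →+* ℝ, SignType.sign (e (((η ^ 2 : (𝓞 K)ˣ) : 𝓞 K) : K)) = 1 := fun e => by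
    have hc : (((η ^ 2 : (𝓞 K)ˣ) : 𝓞 K) : K) = (((η : (𝓞 K)ˣ) : 𝓞 K) : K) ^ 2 := by
      rw [Units.val_pow_eq_pow_val]; push_cast; rfl
    rw [hc, map_pow]
    exact sign_pos (lt_of_le_of_ne (sq_nonneg _) (Ne.symm (pow_ne_zero 2 (emb_units_ne_zero e η))))
  simp only [sgn, h]
  rfl

/-- `sgn(-1) = (-, -, -)`. [folklore] -/
theorem sgn_neg_one : sgn (-1) = (-1, -1, -1) := by
  have h : ∀ e : K →+* ℝ, SignType.sign (e (((-1 : (𝓞 K)ˣ) : 𝓞 K) : K)) = -1 := fun e => by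
    rw [Units.val_neg, Units.val_one]
    push_cast
    rw [map_neg, map_one]
    exact sign_neg (by norm_num)
  simp only [sgn, h]

/-- `sgn(θ) = (-, +, +)`: `r₁ < 0 < r₂, r₃`. [folklore] -/
theorem sgn_unitθ : sgn unitθ = (-1, 1, 1) := by
  have h1 := r₁_spec.1; have h2 := r₂_spec.1; have h3 := r₃_spec.1
  simp only [Set.mem_Ioo] at h1 h2 h3
  simp only [sgn, coe_unitθ, coe_θint, e₁_θ, e₂_θ, e₃_θ]
  rw [sign_neg (by linarith), sign_pos (by linarith), sign_pos (by linarith)]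

/-- `sgn(θ - 1) = (-, -, +)`: `r₁, r₂ < 1 < r₃`. [folklore] -/
theorem sgn_unitθ₁ : sgn unitθ₁ = (-1, -1, 1) := by
  have h1 := r₁_spec.1; have h2 := r₂_spec.1; have h3 := r₃_spec.1
  simp only [Set.mem_Ioo] at h1 h2 h3
  simp only [sgn, coe_unitθ₁, map_sub, map_one, coe_θint, e₁_θ, e₂_θ, e₃_θ]
  rw [sign_neg (by linarith), sign_neg (by linarith), sign_pos (by linarith)]

/-- The eight representatives `±θ^i(θ-1)^j`, `i, j ∈ {0, 1}`. [folklore] -/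
def rep (a i j : Fin 2) : (𝓞 K)ˣ := (-1) ^ (a : ℕ) * unitθ ^ (i : ℕ) * unitθ₁ ^ (j : ℕ)

/-- The sign vectors of the eight representatives are the eight elements of `{±1}³`:
`sgn(±θ^i(θ-1)^j)` runs through all sign patterns. [folklore] -/
theorem sgn_rep (a i j : Fin 2) :
    sgn (rep a i j) = ((-1) ^ (a : ℕ) * (-1) ^ (i : ℕ) * (-1) ^ (j : ℕ),
      (-1) ^ (a : ℕ) * (-1) ^ (j : ℕ), (-1) ^ (a : ℕ)) := by
  have hpow : ∀ (u : (𝓞 K)ˣ) (k : Fin 2), sgn (u ^ (k : ℕ)) = sgn u ^ (k : ℕ) := by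
    intro u k
    fin_cases k
    · simp [sgn]
    · simp
  rw [rep, sgn_mul, sgn_mul, hpow, hpow, hpow, sgn_neg_one, sgn_unitθ, sgn_unitθ₁]
  fin_cases a <;> fin_cases i <;> fin_cases j <;> decide

/-- **A unit of trivial sign vector (totally positive) is a square.** By Dirichlet every unit is
`ρ(e) η²` for one of at most `2 · 2^{rank K} ≤ 8` elements `ρ(e)`; the units `±θ^i(θ-1)^j`
realise all `8` sign vectors, so `sgn ∘ ρ` is a bijection onto `{±1}³`, and `sgn x = 1` forces
`ρ(e) = 1`. In particular `(𝓞 K)ˣ/(𝓞 K)ˣ² ≅ {±1}³` by the signs at the three real places, and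
`-1, θ, θ - 1` represent a basis. [folklore] -/
theorem exists_sq_eq_of_sgn_eq_one (x : (𝓞 K)ˣ) (hx : sgn x = 1) : ∃ η : (𝓞 K)ˣ, x = η ^ 2 := by
  classical
  set F := Units.fundSystem K with hF
  let E := Fin 2 × (Fin (Units.rank K) → Fin 2)
  let ρ : E → (𝓞 K)ˣ := fun e => (-1) ^ (e.1 : ℕ) * ∏ i, F i ^ ((e.2 i : ℕ))
  have hρ0 : ρ (0, fun _ => 0) = 1 := by simp [ρ]
  have hcardE : Fintype.card E ≤ 8 := by
    have hr := units_rank_le_two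
    simp only [E, Fintype.card_prod, Fintype.card_fun, Fintype.card_fin]
    calc 2 * 2 ^ Units.rank K ≤ 2 * 2 ^ 2 :=
          Nat.mul_le_mul_left 2 (Nat.pow_le_pow_right (by norm_num) hr)
      _ = 8 := by norm_num
  let T : Finset (SignType × SignType × SignType) :=
    {(1, 1, 1), (1, 1, -1), (1, -1, 1), (1, -1, -1), (-1, 1, 1), (-1, 1, -1), (-1, -1, 1),
      (-1, -1, -1)}
  have hTcard : T.card = 8 := by decide
  have hred : ∀ y : (𝓞 K)ˣ, ∃ e : E, sgn y = sgn (ρ e) := by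
    intro y
    obtain ⟨s, ε, η, hy⟩ := exists_rep_mul_sq y
    exact ⟨(s, ε), by rw [hy, sgn_mul, sgn_sq, mul_one]⟩
  have hsurjT : T ⊆ Finset.univ.image (sgn ∘ ρ) := by
    intro v hv
    rw [Finset.mem_image]
    have hreal : ∃ y : (𝓞 K)ˣ, sgn y = v := by
      simp only [T, Finset.mem_insert, Finset.mem_singleton] at hv
      rcases hv with rfl | rfl | rfl | rfl | rfl | rfl | rfl | rfl
      · exact ⟨rep 0 0 0, by rw [sgn_rep]; decide⟩
      · exact ⟨rep 1 0 1, by rw [sgn_rep]; decide⟩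
      · exact ⟨rep 0 1 1, by rw [sgn_rep]; decide⟩
      · exact ⟨rep 1 1 0, by rw [sgn_rep]; decide⟩
      · exact ⟨rep 0 1 0, by rw [sgn_rep]; decide⟩
      · exact ⟨rep 1 1 1, by rw [sgn_rep]; decide⟩
      · exact ⟨rep 0 0 1, by rw [sgn_rep]; decide⟩
      · exact ⟨rep 1 0 0, by rw [sgn_rep]; decide⟩
    obtain ⟨y, hy⟩ := hreal
    obtain ⟨e, he⟩ := hred y
    exact ⟨e, Finset.mem_univ e, by rw [Function.comp_apply, ← he, hy]⟩
  have hinj : Set.InjOn (sgn ∘ ρ) (Finset.univ : Finset E) := by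
    rw [← Finset.card_image_iff]
    apply le_antisymm Finset.card_image_le
    calc (Finset.univ : Finset E).card = Fintype.card E := Finset.card_univ
      _ ≤ 8 := hcardE
      _ = T.card := hTcard.symm
      _ ≤ (Finset.univ.image (sgn ∘ ρ)).card := Finset.card_le_card hsurjT
  obtain ⟨s, ε, η, hxe⟩ := exists_rep_mul_sq x
  have hρe : sgn (ρ (s, ε)) = sgn (ρ (0, fun _ => 0)) := by
    rw [hρ0]
    have : sgn x = sgn (ρ (s, ε)) := by rw [hxe, sgn_mul, sgn_sq, mul_one]
    rw [← this, hx]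
    simp only [sgn, Units.val_one, map_one, sign_one]
    rfl
  have he0 : (s, ε) = (0, fun _ => 0) := hinj (Finset.mem_univ _) (Finset.mem_univ _) hρe
  refine ⟨η, ?_⟩
  rw [hxe, show ((-1) ^ (s : ℕ) * ∏ i, F i ^ ((ε i : ℕ)) : (𝓞 K)ˣ) = ρ (s, ε) from rfl, he0, hρ0,
    one_mul]

/-- Each coordinate of a sign vector of a unit is `±1`. [folklore] -/
theorem sgn_coord_cases (x : (𝓞 K)ˣ) (e : K →+* ℝ) :
    SignType.sign (e ((x : 𝓞 K) : K)) = 1 ∨ SignType.sign (e ((x : 𝓞 K) : K)) = -1 := by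
  rcases lt_or_gt_of_ne (emb_units_ne_zero e x) with h | h
  · exact Or.inr (sign_neg h)
  · exact Or.inl (sign_pos h)

/-- Group-theoretic bookkeeping: `x R = η²` gives `x = R (η R⁻¹)²`. [folklore] -/
theorem eq_mul_sq_of_mul_eq_sq {G : Type*} [CommGroup G] {x R η : G} (h : x * R = η ^ 2) :
    x = R * (η * R⁻¹) ^ 2 := by
  rw [mul_pow, inv_pow, ← h, ← mul_assoc, mul_comm R (x * R), mul_assoc x R R, ← pow_two,
    mul_inv_cancel_right]

/-- **Every unit of `K` is `±θ^i (θ - 1)^j` times a square** (`i, j ∈ {0, 1}`): the unit of this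
form with the same sign vector as `x` differs from `x` by a totally positive unit, a square.
[folklore] -/
theorem exists_eq_rep_mul_sq (x : (𝓞 K)ˣ) : ∃ (a i j : Fin 2) (η : (𝓞 K)ˣ), x = rep a i j * η ^ 2 := by
  obtain ⟨v, hv⟩ : ∃ v, sgn x = v := ⟨_, rfl⟩
  have hv1 : v.1 = 1 ∨ v.1 = -1 := by rw [← hv]; exact sgn_coord_cases x e₁
  have hv2 : v.2.1 = 1 ∨ v.2.1 = -1 := by rw [← hv]; exact sgn_coord_cases x e₂
  have hv3 : v.2.2 = 1 ∨ v.2.2 = -1 := by rw [← hv]; exact sgn_coord_cases x e₃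
  obtain ⟨v₁, v₂, v₃⟩ := v
  simp only at hv1 hv2 hv3
  -- a representative `R` with `sgn R = sgn x`, and `sgn (x R) = 1`
  have hR : ∃ a i j : Fin 2, sgn (rep a i j) = (v₁, v₂, v₃) ∧ sgn (x * rep a i j) = 1 := by
    simp_rw [sgn_mul, hv]
    rcases hv1 with rfl | rfl <;> rcases hv2 with rfl | rfl <;> rcases hv3 with rfl | rfl <;>
      first
      | exact ⟨0, 0, 0, by rw [sgn_rep]; decide⟩ | exact ⟨1, 0, 1, by rw [sgn_rep]; decide⟩
      | exact ⟨0, 1, 1, by rw [sgn_rep]; decide⟩ | exact ⟨1, 1, 0, by rw [sgn_rep]; decide⟩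
      | exact ⟨0, 1, 0, by rw [sgn_rep]; decide⟩ | exact ⟨1, 1, 1, by rw [sgn_rep]; decide⟩
      | exact ⟨0, 0, 1, by rw [sgn_rep]; decide⟩ | exact ⟨1, 0, 0, by rw [sgn_rep]; decide⟩
  obtain ⟨a, i, j, -, hsq⟩ := hR
  obtain ⟨η, hη⟩ := exists_sq_eq_of_sgn_eq_one _ hsq
  exact ⟨a, i, j, η * (rep a i j)⁻¹, eq_mul_sq_of_mul_eq_sq hη⟩

/-- **A totally positive unit of `K` is a square** (signs under `e₁, e₂, e₃`). [folklore] -/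
theorem exists_sq_eq_of_pos (x : (𝓞 K)ˣ) (h₁ : 0 < e₁ ((x : 𝓞 K) : K)) (h₂ : 0 < e₂ ((x : 𝓞 K) : K))
    (h₃ : 0 < e₃ ((x : 𝓞 K) : K)) : ∃ η : (𝓞 K)ˣ, x = η ^ 2 :=
  exists_sq_eq_of_sgn_eq_one x (by simp only [sgn, sign_pos h₁, sign_pos h₂, sign_pos h₃]; rfl)

end CyclicCubic13

end Literature.NumberTheory.NumberFields

end
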